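import Mathlib
import HarnessLib
import Literature.Probability.MarkovChains.TotalVariation
import Summits.Ventures.LatticeQCDFlow.Exactness.FlowMCMC
import Summits.Ventures.LatticeQCDFlow.Exactness.JarzynskiFinite
import Summits.Ventures.LatticeQCDFlow.Exactness.BennettAcceptanceRatio
import Summits.Ventures.LatticeQCDFlow.Scaling.StochasticFlows
import Summits.Ventures.LatticeQCDFlow.Scaling.Bhattacharyya
import Summits.Ventures.LatticeQCDFlow.Scaling.Acceptance

/-!
# The acceptance functional of a Metropolized non-equilibrium switch (NCMC): `acc = 1 − TV(P_F, P_R)`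

HONEST FRAMING: exact (Metropolis-corrected) sampling algorithms for lattice gauge theory;
figures of merit are autocorrelation/cost numbers at stated couplings and volumes; no
continuum-physics claim.

Venture `LatticeQCDFlow` (cell pub-lqcd), topic `Exactness`; FANOUT row 8 (`s0-cpn-nemc`, GEN-8).
NEW WORK of the cell (elementary finite sums), not a published result; nothing is cited as a fact.
The constructions are named only: J. P. Nilmeier, G. E. Crooks, D. D. L. Minh, J. D. Chodera,
PNAS 108 (2011) E1009 (non-equilibrium candidate Monte Carlo, NCMC: a driven switch
`λ_0 → λ_n` proposed from the current state and accepted with a work-based Metropolis test);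
G. E. Crooks, J. Stat. Phys. 90 (1998) 1481 (pathwise fluctuation theorem).  The registry lever is
`correction = ncmc-metropolis` (LEVERS.md families C/G).  Companion file:
`Exactness/NCMCAcceptanceBounds.lean` (caps and floors of the same functional).

## Setting (the tree's path vocabulary, nothing re-declared)

A protocol `S 0, …, S n` on a finite configuration space with kernels `P k` leaving `e^{-S (k+1)}`
invariant (`Exactness/JarzynskiFinite.lean`: `pathLaw`, `work`, `gibbsLaw`, `freeEnergy`); the
forward path law `P_F = pathLaw (gibbsLaw (S 0)) P` (equilibrium start in the PRIOR ensemble, e.g.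
open / defect boundary, then the driven evolution to the TARGET, e.g. periodic); the reverse path
law `P_R = Theory2.revPathLaw S P` (equilibrium start in the target, time-reversed kernels, indexed by
forward time; `Scaling/StochasticFlows.lean`), which by Crooks' pathwise identity
(`Theory2.crooks_pathwise`, stationarity only) is `P_R(ω) = P_F(ω) e^{-(W(ω) − ΔF)}`,
`ΔF = freeEnergy (S n) − freeEnergy (S 0)` (`revPathLaw_eq_pathLaw_mul_exp`).

The ONE-WAY METROPOLIZED SWITCH (Nilmeier et al.'s NCMC in the expanded ensemble
`{prior, target} × X` with both levels normalised): from a prior state `x ∼ e^{-S 0}/Z 0` run the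
forward evolution `ω` and accept the target end state `ω n` with probability
`min 1 e^{-(W(ω) − ΔF)}`; the reverse move runs the reversed kernels down from a target state and
accepts with `min 1 e^{+(W − ΔF)}`.  Its STATIONARY MEAN ACCEPTANCE is the functional
`ncmcAccRate S P = Σ_ω P_F(ω) min(1, e^{-(W(ω) − ΔF)})` — the single-proposal (non-IMH) counterpart
of the path-IMH functional `accRate P_R P_F` of `Exactness/FlowMCMC.lean` / `Exactness/PathIMH.lean`
(independent evolutions compared pairwise).

## Content

* `revPathLaw_eq_pathLaw_mul_exp`, `pathLaw_mul_min_eq` — Crooks' tilt and the termwise identity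
  `P_F min(1, e^{-(W − ΔF)}) = min(P_F, P_R)`.
* `ncmcAccRate_eq_sum_min`, **`ncmcAccRate_eq_one_sub_tvDist`** — `acc_NCMC = Σ_ω min(P_F, P_R)
  = 1 − ‖P_F − P_R‖_TV` EXACTLY (for path-IMH, T2-E only gives `≤`); `ncmcRevAccRate_eq_ncmcAccRate`
  — the reverse move accepts equally often; `ncmcAccRate_nonneg`, `ncmcAccRate_le_one`;
  **`ncmcAccRate_eq_one_iff`** — sure acceptance iff EVERY path is dissipation-free (`W ≡ ΔF`).
* **`ncmcAccRate_eq_prob_add_prob`** — Crooks / Nilmeier form: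
  `acc_NCMC = P_F(W ≤ ΔF) + P_R(W > ΔF)`, the total probability of non-positive dissipation in the
  two directions (for a palindromic protocol, `2·P(W < 0) + P(W = 0)`).
* **`accRate_path_le_ncmcAccRate`**, `two_mul_ncmcAccRate_sub_one_le_accRate_path` — per proposal,
  path-IMH accepts at most as often as the NCMC switch and at least `2 acc_NCMC − 1` (T2-E / T2-X
  on path space): the two exact Metropolizations of one protocol sit in the window `[2a − 1, a]`.

Reading.  Every quantity here is a functional of the forward work distribution and of `ΔF`, i.e.
of numbers an NE-MCMC run already records; the Gaussian-work values (`acc_NCMC = 2Φ(−σ/2)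
= erfc(½√⟨W_d⟩)`, `acc_IMH = 2Φ(−σ/√2)` for `W − ΔF ∼ N(σ²/2, σ²)`) are a continuum dictionary and
are NOT typed here.  Nothing in this file is specific to CP(N−1) or to a gauge group.
-/

namespace Summit.Ventures.LatticeQCDFlow.Exactness

open Finset
open Literature.Probability.MarkovChains
open Summit.Ventures.LatticeQCDFlow.Theory2 (revPathLaw pathLaw_pos pathLaw_nonneg revPathLaw_pos
  revPathLaw_nonneg gibbsLaw_pos sum_gibbsLaw sum_revPathLaw sum_min_eq_one_sub_tvDist
  one_sub_two_tvDist_le_accRate)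

variable {X : Type*} [Fintype X] {n : ℕ}

/-! ## The functional -/

/-- **Stationary mean acceptance of the Metropolized non-equilibrium switch (NCMC, one-way move).**
From an equilibrium prior state run the forward evolution `ω ∼ P_F` and accept with the Crooks
ratio `min 1 e^{-(W(ω) − ΔF)}`, `ΔF = freeEnergy (S n) − freeEnergy (S 0)`. -/
noncomputable def ncmcAccRate (S : Fin (n + 1) → X → ℝ) (P : Fin n → X → X → ℝ) : ℝ :=
  ∑ ω : Fin (n + 1) → X, pathLaw (gibbsLaw (S 0)) P ω *
    min 1 (Real.exp (-(work S ω - (freeEnergy (S (Fin.last n)) - freeEnergy (S 0)))))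

/-- Stationary mean acceptance of the REVERSE move: from an equilibrium target state run the
reversed kernels down the protocol (`ω ∼ P_R`, indexed by forward time, reverse work `−W(ω)`) and
accept with `min 1 e^{-(−W(ω) + ΔF)} = min 1 e^{W(ω) − ΔF}`. -/
noncomputable def ncmcRevAccRate [Nonempty X] (S : Fin (n + 1) → X → ℝ) (P : Fin n → X → X → ℝ) :
    ℝ :=
  ∑ ω : Fin (n + 1) → X, revPathLaw S P ω *
    min 1 (Real.exp (work S ω - (freeEnergy (S (Fin.last n)) - freeEnergy (S 0))))

/-! ## Crooks: the reverse path law is the forward law tilted by the dissipated work -/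

/-- `P_R(ω) = P_F(ω) · e^{-(W(ω) − ΔF)}` for EVERY path: `Theory2.crooks_pathwise` with
`Z n / Z 0 = e^{-ΔF}` (`partitionFn_div_eq_exp_neg_freeEnergy_sub`). -/
theorem revPathLaw_eq_pathLaw_mul_exp [Nonempty X] (S : Fin (n + 1) → X → ℝ)
    (P : Fin n → X → X → ℝ) (ω : Fin (n + 1) → X) :
    revPathLaw S P ω = pathLaw (gibbsLaw (S 0)) P ω *
      Real.exp (-(work S ω - (freeEnergy (S (Fin.last n)) - freeEnergy (S 0)))) := by
  have hc := Theory2.crooks_pathwise S P ω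
  rw [partitionFn_div_eq_exp_neg_freeEnergy_sub (S 0) (S (Fin.last n))] at hc
  have hE : Real.exp (-(work S ω - (freeEnergy (S (Fin.last n)) - freeEnergy (S 0)))) =
      Real.exp (-(work S ω)) * Real.exp (freeEnergy (S (Fin.last n)) - freeEnergy (S 0)) := by
    rw [← Real.exp_add]
    congr 1
    ring
  rw [hE, ← mul_assoc, hc, mul_right_comm, ← Real.exp_add, neg_add_cancel, Real.exp_zero, one_mul]

/-- Pathwise: `P_F(ω) · min(1, e^{-(W − ΔF)}) = min(P_F(ω), P_R(ω))`. -/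
theorem pathLaw_mul_min_eq [Nonempty X] (S : Fin (n + 1) → X → ℝ) {P : Fin n → X → X → ℝ}
    (hP : ∀ k x y, 0 ≤ P k x y) (ω : Fin (n + 1) → X) :
    pathLaw (gibbsLaw (S 0)) P ω *
        min 1 (Real.exp (-(work S ω - (freeEnergy (S (Fin.last n)) - freeEnergy (S 0))))) =
      min (pathLaw (gibbsLaw (S 0)) P ω) (revPathLaw S P ω) := by
  rw [mul_min_of_nonneg _ _ (pathLaw_nonneg (fun x => (gibbsLaw_pos (S 0) x).le) hP ω), mul_one,
    ← revPathLaw_eq_pathLaw_mul_exp]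

/-! ## `acc = Σ min(P_F, P_R) = 1 − TV(P_F, P_R)` -/

/-- `acc_NCMC = Σ_ω min(P_F(ω), P_R(ω))`. -/
theorem ncmcAccRate_eq_sum_min [Nonempty X] (S : Fin (n + 1) → X → ℝ) {P : Fin n → X → X → ℝ}
    (hP : ∀ k x y, 0 ≤ P k x y) :
    ncmcAccRate S P = ∑ ω : Fin (n + 1) → X, min (pathLaw (gibbsLaw (S 0)) P ω) (revPathLaw S P ω) := by
  unfold ncmcAccRate
  exact sum_congr rfl fun ω _ => pathLaw_mul_min_eq S hP ω

/-- The forward path law is a probability vector (row-stochastic kernels). -/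
theorem sum_pathLaw_gibbs_eq_one [Nonempty X] (S : Fin (n + 1) → X → ℝ) {P : Fin n → X → X → ℝ}
    (hP : ∀ k, IsRowStochastic (P k)) : ∑ ω : Fin (n + 1) → X, pathLaw (gibbsLaw (S 0)) P ω = 1 := by
  rw [sum_pathLaw _ _ (fun k => (hP k).2), sum_gibbsLaw]

/-- **THE NCMC ACCEPTANCE IDENTITY.**  For row-stochastic kernels leaving the intermediate
Boltzmann weights invariant, `acc_NCMC = 1 − ‖P_F − P_R‖_TV` EXACTLY: the Metropolized switch
accepts with the overlap of the forward and reverse path ensembles (no detailed balance of the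
kernels is needed, only stationarity). -/
theorem ncmcAccRate_eq_one_sub_tvDist [Nonempty X] (S : Fin (n + 1) → X → ℝ)
    {P : Fin n → X → X → ℝ} (hP : ∀ k, IsRowStochastic (P k))
    (hst : ∀ k : Fin n, IsStationary (fun x => Real.exp (-(S k.succ x))) (P k)) :
    ncmcAccRate S P = 1 - tvDist (pathLaw (gibbsLaw (S 0)) P) (revPathLaw S P) := by
  rw [ncmcAccRate_eq_sum_min S (fun k => (hP k).1)]
  exact sum_min_eq_one_sub_tvDist (sum_pathLaw_gibbs_eq_one S hP) (sum_revPathLaw S P hst)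

/-- The reverse move accepts exactly as often as the forward move (`min` is symmetric and
`P_R e^{W − ΔF} = P_F`). -/
theorem ncmcRevAccRate_eq_ncmcAccRate [Nonempty X] (S : Fin (n + 1) → X → ℝ)
    {P : Fin n → X → X → ℝ} (hP : ∀ k x y, 0 ≤ P k x y) :
    ncmcRevAccRate S P = ncmcAccRate S P := by
  rw [ncmcAccRate_eq_sum_min S hP]
  unfold ncmcRevAccRate
  refine sum_congr rfl fun ω _ => ?_
  rw [mul_min_of_nonneg _ _ (revPathLaw_nonneg S hP ω), mul_one, min_comm]
  congr 1
  rw [revPathLaw_eq_pathLaw_mul_exp S P ω, mul_assoc, ← Real.exp_add, neg_add_cancel,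
    Real.exp_zero, mul_one]

/-- `0 ≤ acc_NCMC`. -/
theorem ncmcAccRate_nonneg [Nonempty X] (S : Fin (n + 1) → X → ℝ) {P : Fin n → X → X → ℝ}
    (hP : ∀ k x y, 0 ≤ P k x y) : 0 ≤ ncmcAccRate S P :=
  sum_nonneg fun ω _ => mul_nonneg (pathLaw_nonneg (fun x => (gibbsLaw_pos (S 0) x).le) hP ω)
    (le_min zero_le_one (Real.exp_pos _).le)

/-- `acc_NCMC ≤ 1`. -/
theorem ncmcAccRate_le_one [Nonempty X] (S : Fin (n + 1) → X → ℝ) {P : Fin n → X → X → ℝ}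
    (hP : ∀ k, IsRowStochastic (P k)) : ncmcAccRate S P ≤ 1 := by
  calc ncmcAccRate S P ≤ ∑ ω : Fin (n + 1) → X, pathLaw (gibbsLaw (S 0)) P ω := by
        refine sum_le_sum fun ω _ => ?_
        have hF := pathLaw_nonneg (fun x => (gibbsLaw_pos (S 0) x).le) (fun k => (hP k).1) ω
        calc pathLaw (gibbsLaw (S 0)) P ω *
              min 1 (Real.exp (-(work S ω - (freeEnergy (S (Fin.last n)) - freeEnergy (S 0)))))
            ≤ pathLaw (gibbsLaw (S 0)) P ω * 1 := mul_le_mul_of_nonneg_left (min_le_left _ _) hF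
          _ = pathLaw (gibbsLaw (S 0)) P ω := mul_one _
    _ = 1 := sum_pathLaw_gibbs_eq_one S hP

/-- **Sure acceptance iff no dissipation.**  With positive kernels, `acc_NCMC = 1` iff `W(ω) = ΔF`
on EVERY path (the quasi-static / perfectly transporting protocol); any work fluctuation costs
acceptance. -/
theorem ncmcAccRate_eq_one_iff [Nonempty X] (S : Fin (n + 1) → X → ℝ) {P : Fin n → X → X → ℝ}
    (hP : ∀ k, IsRowStochastic (P k)) (hPpos : ∀ k x y, 0 < P k x y)
    (hst : ∀ k : Fin n, IsStationary (fun x => Real.exp (-(S k.succ x))) (P k)) :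
    ncmcAccRate S P = 1 ↔
      ∀ ω : Fin (n + 1) → X, work S ω = freeEnergy (S (Fin.last n)) - freeEnergy (S 0) := by
  rw [ncmcAccRate_eq_one_sub_tvDist S hP hst, sub_eq_self, tvDist_eq_zero_iff]
  constructor
  · intro h ω
    have hω := congrFun h ω
    rw [revPathLaw_eq_pathLaw_mul_exp S P ω] at hω
    have hF := pathLaw_pos (gibbsLaw_pos (S 0)) hPpos ω
    have hexp : Real.exp (-(work S ω - (freeEnergy (S (Fin.last n)) - freeEnergy (S 0)))) = 1 :=
      mul_left_cancel₀ hF.ne' (hω.symm.trans (mul_one _).symm)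
    have := (Real.exp_eq_one_iff _).mp hexp
    linarith
  · intro h
    funext ω
    rw [revPathLaw_eq_pathLaw_mul_exp S P ω, h ω, sub_self, neg_zero, Real.exp_zero, mul_one]

/-! ## The Crooks / Nilmeier form: probabilities of non-positive dissipation -/

/-- **`acc_NCMC = P_F(W ≤ ΔF) + P_R(W > ΔF)`.**  Termwise `min(P_F, P_R)` is `P_F` where the forward
dissipation `W − ΔF` is `≤ 0` and `P_R` where it is `> 0`; on the reverse side `W > ΔF` says that the
REVERSE evolution (work `−W`, free-energy change `−ΔF`) dissipates `< 0`.  For a palindromic protocol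
(`P_R = P_F ∘ reversal`, `ΔF = 0`) this is Nilmeier et al.'s `2·P(W < 0) + P(W = 0)`. -/
theorem ncmcAccRate_eq_prob_add_prob [Nonempty X] (S : Fin (n + 1) → X → ℝ)
    {P : Fin n → X → X → ℝ} (hP : ∀ k x y, 0 ≤ P k x y) :
    ncmcAccRate S P =
      (∑ ω ∈ univ.filter (fun ω : Fin (n + 1) → X =>
          work S ω ≤ freeEnergy (S (Fin.last n)) - freeEnergy (S 0)), pathLaw (gibbsLaw (S 0)) P ω) +
        ∑ ω ∈ univ.filter (fun ω : Fin (n + 1) → X =>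
          freeEnergy (S (Fin.last n)) - freeEnergy (S 0) < work S ω), revPathLaw S P ω := by
  rw [ncmcAccRate_eq_sum_min S hP]
  have key : ∀ ω : Fin (n + 1) → X, min (pathLaw (gibbsLaw (S 0)) P ω) (revPathLaw S P ω) =
      if work S ω ≤ freeEnergy (S (Fin.last n)) - freeEnergy (S 0) then pathLaw (gibbsLaw (S 0)) P ω
      else revPathLaw S P ω := by
    intro ω
    have hF := pathLaw_nonneg (fun x => (gibbsLaw_pos (S 0) x).le) hP ω
    rw [revPathLaw_eq_pathLaw_mul_exp S P ω]
    split_ifs with h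
    · refine min_eq_left ?_
      calc pathLaw (gibbsLaw (S 0)) P ω = pathLaw (gibbsLaw (S 0)) P ω * 1 := (mul_one _).symm
        _ ≤ pathLaw (gibbsLaw (S 0)) P ω *
              Real.exp (-(work S ω - (freeEnergy (S (Fin.last n)) - freeEnergy (S 0)))) :=
            mul_le_mul_of_nonneg_left (Real.one_le_exp (by linarith)) hF
    · refine min_eq_right ?_
      calc pathLaw (gibbsLaw (S 0)) P ω *
              Real.exp (-(work S ω - (freeEnergy (S (Fin.last n)) - freeEnergy (S 0))))
          ≤ pathLaw (gibbsLaw (S 0)) P ω * 1 :=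
            mul_le_mul_of_nonneg_left (Real.exp_le_one_iff.mpr (by linarith [not_le.mp h])) hF
        _ = pathLaw (gibbsLaw (S 0)) P ω := mul_one _
  rw [sum_congr rfl fun ω _ => key ω, sum_ite]
  congr 1
  refine sum_congr ?_ fun _ _ => rfl
  ext ω
  simp only [mem_filter, mem_univ, true_and, not_le]

/-! ## Path-IMH versus NCMC on the same protocol -/

/-- **Per proposal, path-IMH accepts at most as often as the NCMC switch:**
`accRate P_R P_F ≤ 1 − TV(P_R, P_F) = acc_NCMC` (T2-E `accRate_le` on path space).  The two exact
Metropolizations of one and the same protocol differ in what they compare the fresh evolution with: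
IMH with the previous evolution, NCMC with the reverse ensemble. -/
theorem accRate_path_le_ncmcAccRate [Nonempty X] (S : Fin (n + 1) → X → ℝ)
    {P : Fin n → X → X → ℝ} (hP : ∀ k, IsRowStochastic (P k))
    (hst : ∀ k : Fin n, IsStationary (fun x => Real.exp (-(S k.succ x))) (P k)) :
    accRate (revPathLaw S P) (pathLaw (gibbsLaw (S 0)) P) ≤ ncmcAccRate S P := by
  classical
  rw [ncmcAccRate_eq_one_sub_tvDist S hP hst, tvDist_comm]
  exact accRate_le (sum_revPathLaw S P hst) (sum_pathLaw_gibbs_eq_one S hP)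

/-- … and at least `2·acc_NCMC − 1` (T2-X `one_sub_two_tvDist_le_accRate`): the window
`[2a − 1, a]`. -/
theorem two_mul_ncmcAccRate_sub_one_le_accRate_path [Nonempty X] (S : Fin (n + 1) → X → ℝ)
    {P : Fin n → X → X → ℝ} (hP : ∀ k, IsRowStochastic (P k))
    (hst : ∀ k : Fin n, IsStationary (fun x => Real.exp (-(S k.succ x))) (P k)) :
    2 * ncmcAccRate S P - 1 ≤ accRate (revPathLaw S P) (pathLaw (gibbsLaw (S 0)) P) := by
  rw [ncmcAccRate_eq_one_sub_tvDist S hP hst, tvDist_comm]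
  have h := one_sub_two_tvDist_le_accRate (sum_revPathLaw S P hst)
    (pathLaw_nonneg (fun x => (gibbsLaw_pos (S 0) x).le) (fun k => (hP k).1))
    (sum_pathLaw_gibbs_eq_one S hP)
  linarith

end Summit.Ventures.LatticeQCDFlow.Exactness
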